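import Summits.Ventures.LatticeQCDFlow.Scaling.HubChainEigenbasis

/-!
HONEST FRAMING: exact (Metropolis-corrected) sampling algorithms for lattice gauge theory; figures
of merit are autocorrelation/cost numbers at stated couplings and volumes; no continuum-physics
claim.

# HubClassChainEigenbasis — THE SWAP PHASE SOLVED EXACTLY, VII: THE LUMPED (CONTENT-CLASS) HUB CHAIN `P(U,V) = c·N_V·min{1, ρ_V/ρ_U}` OF CHAPTER W (`Kh(N;h,v) = (N(v)/K)·acc(h,v)`) HAS THE SAME
# STRUCTURE WITH CLASS WEIGHTS: EIGENFUNCTIONS `f_k = ρ_k·𝟙_{<k} − (R_k/N_k)·𝟙_k`, EIGENVALUES `β_k = 1 − c(M_k + R_k/ρ_k)` (`R_k = Σ_{i<k}N_iρ_i`, `M_k = Σ_{i≥k}N_i`), REVERSING MEASURE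
# `π = Nρ`, NORMS `ρ_kR_kR_{k+1}/N_k`, AND COMPLETENESS `δ_{ij} = N_jρ_j(1/R_m + Σ_k f_k(i)f_k(j)N_k/(ρ_kR_kR_{k+1}))` (lean-2 GEN-39, ours)

Venture-side (OURS).  Cell `lqcd-flow` (pub-lqcd), unit `pub-lqcd-lean-2-g39`, 2026-08-30.  Chapter Y, file 7 — the dictionary to chapter W made literal.  Within a refresh cycle the hub
CONTENT moves by chapter W's kernel `Kh(N;h,v) = (N(v)/K)·min{1, W_h/W_v}` (`N` the full composition, `v ≠ h`); enumerating the contents present by non-decreasing depth `ρ = 1/W`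
(ranks `0,…,m−1`, class weights `N_k > 0`, ties allowed) this is `P(i,j) = c·N_j·min{1,ρ_j/ρ_i}` (`c = 1/K`), the class-weighted version of file 1's labelled chain (`N ≡ 1`).
Everything of file 1 survives with weights (`R_k = Σ_{i<k}N_iρ_i`, `M_k = Σ_{k≤i<m}N_i`, reversing measure `π_i = N_iρ_i`):

* §1 `hubClass_reversible`, `hubClass_sum_below`, `hubClass_sum_above`, `hubClass_M_succ`, `hubClass_diag` (`P(k,k) = β_k + cN_k`), `hubClass_diag_nonneg`;
* §2 **`hubClass_eigen`** (`Σ_jP(i,j)f_k(j) = β_kf_k(i)`), `hubClass_beta_le` (`β_k ≤ 1 − cN_k`), `hubClass_beta_ge` (`β_k ≥ 1 − cM_0`), `hubClass_beta_mono`;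
* §3 `hubClass_eigen_mean_zero`, `hubClass_eigen_normSq` (`Σ_iπ_if_k(i)² = ρ_kR_kR_{k+1}/N_k`), `hubClass_eigen_orth`;
* §4 **`hubClass_complete`**.

Reading (no numerics implied): with this file the closed laws of files 2–4 transcribe to the lumped star of chapters V–X (replace `ρ_j` by `N_jρ_j` in front and `1/(ρ_kR_kR_{k+1})` by
`N_k/(ρ_kR_kR_{k+1})`; the eigenvalues are those of the labelled chain at class-leading ranks).  Literature grade (cell rule): OWN, elementary; nothing cited; no new bib keys.
-/

open Finset

namespace Summit.Ventures.LatticeQCDFlow.Scaling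

section HubClassEigen
variable {m : ℕ} {ρ N R M β : ℕ → ℝ} {c : ℝ} {P f : ℕ → ℕ → ℝ}

/-! ### §1 The kernel -/

/-- **Reversibility** w.r.t. `π = Nρ`: `N_iρ_iP(i,j) = cN_iN_j·min{ρ_i,ρ_j} = N_jρ_jP(j,i)`. [ours] -/
theorem hubClass_reversible (hρ : ∀ i, 0 < ρ i) (hPoff : ∀ i j, i ≠ j → P i j = c * N j * min 1 (ρ j / ρ i)) (i j : ℕ) :
    N i * ρ i * P i j = N j * ρ j * P j i := by
  by_cases hij : i = j
  · subst hij; rfl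
  have key : ∀ a b, ρ a * min (1 : ℝ) (ρ b / ρ a) = min (ρ a) (ρ b) := by
    intro a b
    rcases le_total (ρ a) (ρ b) with h | h
    · rw [min_eq_left ((one_le_div (hρ a)).mpr h), min_eq_left h, mul_one]
    · rw [min_eq_right ((div_le_one (hρ a)).mpr h), min_eq_right h, mul_div_cancel₀ _ (hρ a).ne']
  rw [hPoff i j hij, hPoff j i (Ne.symm hij)]
  calc N i * ρ i * (c * N j * min 1 (ρ j / ρ i)) = c * N i * N j * (ρ i * min 1 (ρ j / ρ i)) := by ring
    _ = c * N i * N j * (ρ j * min 1 (ρ i / ρ j)) := by rw [key, key, min_comm]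
    _ = N j * ρ j * (c * N i * min 1 (ρ i / ρ j)) := by ring

/-- From a start `i` at least as deep as every `j < k` (`k ≤ i`): `Σ_{j<k} P(i,j) = cR_k/ρ_i`. [ours] -/
theorem hubClass_sum_below (hρ : ∀ i, 0 < ρ i) (hmono : Monotone ρ) (hR : ∀ k, R k = ∑ i ∈ range k, N i * ρ i)
    (hPoff : ∀ i j, i ≠ j → P i j = c * N j * min 1 (ρ j / ρ i)) {i k : ℕ} (hki : k ≤ i) :
    ∑ j ∈ range k, P i j = c * R k / ρ i := by
  rw [hR k, Finset.mul_sum, Finset.sum_div]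
  refine sum_congr rfl fun j hj => ?_
  have hji : j < i := lt_of_lt_of_le (mem_range.mp hj) hki
  rw [hPoff i j (by omega), hubChain_min_of_ge hρ hmono hji.le]; ring

/-- From a start `i` shallower than `k` (`i < k`): `Σ_{k ≤ j < m} P(i,j) = c·M_k` (every deeper class is accepted). [ours] -/
theorem hubClass_sum_above (hρ : ∀ i, 0 < ρ i) (hmono : Monotone ρ) (hM : ∀ k, M k = ∑ i ∈ Ico k m, N i)
    (hPoff : ∀ i j, i ≠ j → P i j = c * N j * min 1 (ρ j / ρ i)) {i k : ℕ} (hik : i < k) : ∑ j ∈ Ico k m, P i j = c * M k := by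
  rw [hM k, mul_sum]
  refine sum_congr rfl fun j hj => ?_
  have hkj : k ≤ j := (mem_Ico.mp hj).1
  rw [hPoff i j (by omega), hubChain_min_of_le hρ hmono (by omega : i ≤ j), mul_one]

/-- `M_k = N_k + M_{k+1}` for `k < m`, and `M_m = 0`. [ours] -/
theorem hubClass_M_succ (hM : ∀ k, M k = ∑ i ∈ Ico k m, N i) {k : ℕ} (hk : k < m) : M k = N k + M (k + 1) := by
  rw [hM k, hM (k + 1), Finset.sum_eq_sum_Ico_succ_bot hk]

/-- **The diagonal:** `P(k,k) = β_k + cN_k` with `β_k = 1 − c(M_k + R_k/ρ_k)`, for `k < m`. [ours] -/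
theorem hubClass_diag (hρ : ∀ i, 0 < ρ i) (hmono : Monotone ρ) (hR : ∀ k, R k = ∑ i ∈ range k, N i * ρ i) (hM : ∀ k, M k = ∑ i ∈ Ico k m, N i)
    (hPoff : ∀ i j, i ≠ j → P i j = c * N j * min 1 (ρ j / ρ i)) (hPdiag : ∀ i, P i i = 1 - ∑ j ∈ (range m).erase i, P i j)
    (hβ : ∀ k, β k = 1 - c * (M k + R k / ρ k)) {k : ℕ} (hk : k < m) : P k k = β k + c * N k := by
  have hrow := hubChain_rowsum hPdiag hk
  rw [hubChain_split3 hk, hubClass_sum_below hρ hmono hR hPoff le_rfl, hubClass_sum_above hρ hmono hM hPoff (Nat.lt_succ_self k)] at hrow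
  rw [hβ k, hubClass_M_succ hM hk]
  have : c * R k / ρ k = c * (R k / ρ k) := by ring
  rw [this] at hrow
  linarith

/-- The diagonal is non-negative as soon as `c·(M_0 − N_k) ≤ 1` (e.g. `c = 1/K`, `M_0 = K+1`, `N_k ≥ 1`). [ours] -/
theorem hubClass_diag_nonneg (hρ : ∀ i, 0 < ρ i) (hmono : Monotone ρ) (hN : ∀ i, 0 < N i) (hR : ∀ k, R k = ∑ i ∈ range k, N i * ρ i)
    (hM : ∀ k, M k = ∑ i ∈ Ico k m, N i)
    (hPoff : ∀ i j, i ≠ j → P i j = c * N j * min 1 (ρ j / ρ i)) (hPdiag : ∀ i, P i i = 1 - ∑ j ∈ (range m).erase i, P i j)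
    (hβ : ∀ k, β k = 1 - c * (M k + R k / ρ k)) (hc : 0 ≤ c) {k : ℕ} (hk : k < m) (hcm : c * (M 0 - N k) ≤ 1) : 0 ≤ P k k := by
  rw [hubClass_diag hρ hmono hR hM hPoff hPdiag hβ hk, hβ k]
  -- `R_k ≤ ρ_k·Σ_{i<k}N_i` and `M_0 = Σ_{i<k}N_i + M_k`
  have hRk : R k ≤ ρ k * ∑ i ∈ range k, N i := by
    rw [hR k, mul_sum]
    exact sum_le_sum fun i hi => by rw [mul_comm]; exact mul_le_mul_of_nonneg_right (hmono (mem_range.mp hi).le) (hN i).le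
  have h1 : R k / ρ k ≤ ∑ i ∈ range k, N i := by rw [div_le_iff₀ (hρ k)]; linarith
  have hM0 : M 0 = (∑ i ∈ range k, N i) + M k := by
    rw [hM 0, hM k, range_eq_Ico]; exact (Finset.sum_Ico_consecutive _ (Nat.zero_le k) hk.le).symm
  nlinarith

/-! ### §2 The eigenfunctions -/

/-- **THE EIGEN-EQUATION (class weights).**  For `k, i < m`: `Σ_{j<m} P(i,j)f_k(j) = β_k·f_k(i)`, `f_k(j) = ρ_k` (`j<k`), `−R_k/N_k` (`j=k`), `0` (`j>k`), `β_k = 1 − c(M_k + R_k/ρ_k)`. [ours] -/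
theorem hubClass_eigen (hρ : ∀ i, 0 < ρ i) (hmono : Monotone ρ) (hN : ∀ i, 0 < N i) (hR : ∀ k, R k = ∑ i ∈ range k, N i * ρ i)
    (hM : ∀ k, M k = ∑ i ∈ Ico k m, N i)
    (hPoff : ∀ i j, i ≠ j → P i j = c * N j * min 1 (ρ j / ρ i)) (hPdiag : ∀ i, P i i = 1 - ∑ j ∈ (range m).erase i, P i j)
    (hf : ∀ k i, f k i = if i < k then ρ k else if i = k then -(R k / N k) else 0)
    (hβ : ∀ k, β k = 1 - c * (M k + R k / ρ k)) {k i : ℕ} (hk : k < m) (hi : i < m) :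
    ∑ j ∈ range m, P i j * f k j = β k * f k i := by
  have hsum : ∑ j ∈ range m, P i j * f k j = ρ k * ∑ j ∈ range k, P i j - R k / N k * P i k := by
    rw [hubChain_split3 hk]
    have h1 : ∑ j ∈ range k, P i j * f k j = ρ k * ∑ j ∈ range k, P i j := by
      rw [mul_sum]; exact sum_congr rfl fun j hj => by rw [hf, if_pos (mem_range.mp hj)]; ring
    have h2 : P i k * f k k = -(R k / N k * P i k) := by rw [hf, if_neg (lt_irrefl k), if_pos rfl]; ring
    have h3 : ∑ j ∈ Ico (k + 1) m, P i j * f k j = 0 := by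
      refine sum_eq_zero fun j hj => ?_
      have : k + 1 ≤ j := (mem_Ico.mp hj).1
      rw [hf, if_neg (by omega), if_neg (by omega), mul_zero]
    rw [h1, h2, h3]; ring
  rw [hsum]
  have hNk := (hN k).ne'
  rcases lt_trichotomy i k with hlt | heq | hgt
  · have hrow := hubChain_rowsum hPdiag hi
    rw [hubChain_split3 hk, hubClass_sum_above hρ hmono hM hPoff (by omega : i < k + 1)] at hrow
    have hMk := hubClass_M_succ hM hk
    have hPik : P i k = c * N k := by rw [hPoff i k (by omega), hubChain_min_of_le hρ hmono hlt.le, mul_one]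
    rw [hPik] at hrow ⊢
    rw [hf, if_pos hlt, hβ k]
    have : ∑ j ∈ range k, P i j = 1 - c * M k := by rw [hMk]; linarith
    rw [this]
    have hρk := (hρ k).ne'
    field_simp
    ring
  · subst heq
    rw [hubClass_sum_below hρ hmono hR hPoff le_rfl, hubClass_diag hρ hmono hR hM hPoff hPdiag hβ hk, hf, if_neg (lt_irrefl i), if_pos rfl, hβ i]
    have hρk := (hρ i).ne'
    field_simp
    ring
  · have hPik : P i k = c * N k * (ρ k / ρ i) := by rw [hPoff i k (by omega), hubChain_min_of_ge hρ hmono hgt.le]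
    rw [hubClass_sum_below hρ hmono hR hPoff hgt.le, hPik, hf, if_neg (by omega), if_neg (by omega)]
    have hρi := (hρ i).ne'
    field_simp
    ring

/-- `β_k ≤ 1 − cN_k` (for `c ≥ 0`). [ours] -/
theorem hubClass_beta_le (hρ : ∀ i, 0 < ρ i) (hN : ∀ i, 0 < N i) (hR : ∀ k, R k = ∑ i ∈ range k, N i * ρ i) (hM : ∀ k, M k = ∑ i ∈ Ico k m, N i)
    (hβ : ∀ k, β k = 1 - c * (M k + R k / ρ k)) (hc : 0 ≤ c) {k : ℕ} (hk : k < m) : β k ≤ 1 - c * N k := by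
  rw [hβ k, hubClass_M_succ hM hk]
  have hR0 : 0 ≤ R k := by rw [hR k]; exact sum_nonneg fun i _ => mul_nonneg (hN i).le (hρ i).le
  have hM0 : 0 ≤ M (k + 1) := by rw [hM]; exact sum_nonneg fun i _ => (hN i).le
  have h2 : 0 ≤ R k / ρ k := div_nonneg hR0 (hρ k).le
  nlinarith

/-- `β_k ≥ 1 − c·M_0` (for `c ≥ 0`; `M_0 = Σ_{i<m}N_i` the total weight). [ours] -/
theorem hubClass_beta_ge (hρ : ∀ i, 0 < ρ i) (hmono : Monotone ρ) (hN : ∀ i, 0 < N i) (hR : ∀ k, R k = ∑ i ∈ range k, N i * ρ i)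
    (hM : ∀ k, M k = ∑ i ∈ Ico k m, N i) (hβ : ∀ k, β k = 1 - c * (M k + R k / ρ k)) (hc : 0 ≤ c) {k : ℕ} (hk : k < m) : 1 - c * M 0 ≤ β k := by
  rw [hβ k]
  have hRk : R k ≤ ρ k * ∑ i ∈ range k, N i := by
    rw [hR k, mul_sum]
    exact sum_le_sum fun i hi => by rw [mul_comm]; exact mul_le_mul_of_nonneg_right (hmono (mem_range.mp hi).le) (hN i).le
  have h1 : R k / ρ k ≤ ∑ i ∈ range k, N i := by rw [div_le_iff₀ (hρ k)]; linarith
  have hM0 : M 0 = (∑ i ∈ range k, N i) + M k := by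
    rw [hM 0, hM k, range_eq_Ico]; exact (Finset.sum_Ico_consecutive _ (Nat.zero_le k) hk.le).symm
  nlinarith

/-- **`β` is non-decreasing in the depth rank** (for `c ≥ 0`). [ours] -/
theorem hubClass_beta_mono (hρ : ∀ i, 0 < ρ i) (hmono : Monotone ρ) (hN : ∀ i, 0 < N i) (hR : ∀ k, R k = ∑ i ∈ range k, N i * ρ i)
    (hM : ∀ k, M k = ∑ i ∈ Ico k m, N i) (hβ : ∀ k, β k = 1 - c * (M k + R k / ρ k)) (hc : 0 ≤ c) {k l : ℕ} (hkl : k ≤ l) (hl : l < m) :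
    β k ≤ β l := by
  suffices step : ∀ j, j + 1 < m → β j ≤ β (j + 1) by
    induction l with
    | zero => rw [Nat.le_zero.mp hkl]
    | succ l ih =>
        rcases Nat.lt_or_ge k (l + 1) with h | h
        · exact (ih (by omega) (by omega)).trans (step l hl)
        · rw [le_antisymm hkl h]
  intro j hj
  rw [hβ j, hβ (j + 1), hR (j + 1), sum_range_succ, ← hR j, hubClass_M_succ hM (by omega : j < m)]
  have hρj := hρ j; have hρj1 := hρ (j + 1); have hjj := hmono (Nat.le_succ j); have hNj := hN j
  have hR0 : 0 ≤ R j := by rw [hR j]; exact sum_nonneg fun i _ => mul_nonneg (hN i).le (hρ i).le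
  -- `(R_j + N_jρ_j)/ρ_{j+1} ≤ R_j/ρ_j + N_j`
  have key : (R j + N j * ρ j) / ρ (j + 1) ≤ R j / ρ j + N j := by
    rw [div_le_iff₀ hρj1]
    have h1 : R j / ρ j * ρ (j + 1) ≥ R j := by
      have : R j / ρ j * ρ (j + 1) = R j * (ρ (j + 1) / ρ j) := by ring
      rw [this]; exact le_mul_of_one_le_right hR0 ((one_le_div hρj).mpr hjj)
    nlinarith
  nlinarith

/-! ### §3 Orthogonality relations (weight `π = Nρ`) -/

/-- Splitting `Σ_{i<m} N_iρ_i·f_k(i)·g(i)` by the support of `f_k`. [ours] -/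
theorem hubClass_eigen_sum (hN : ∀ i, 0 < N i) (hf : ∀ k i, f k i = if i < k then ρ k else if i = k then -(R k / N k) else 0)
    {k : ℕ} (hk : k < m) (g : ℕ → ℝ) :
    ∑ i ∈ range m, N i * ρ i * f k i * g i = ρ k * ∑ i ∈ range k, N i * ρ i * g i - R k * (ρ k * g k) := by
  rw [hubChain_split3 hk]
  have h1 : ∑ i ∈ range k, N i * ρ i * f k i * g i = ρ k * ∑ i ∈ range k, N i * ρ i * g i := by
    rw [mul_sum]; exact sum_congr rfl fun i hi => by rw [hf, if_pos (mem_range.mp hi)]; ring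
  have h2 : N k * ρ k * f k k * g k = -(R k * (ρ k * g k)) := by
    rw [hf, if_neg (lt_irrefl k), if_pos rfl]; have := (hN k).ne'; field_simp
  have h3 : ∑ i ∈ Ico (k + 1) m, N i * ρ i * f k i * g i = 0 := by
    refine sum_eq_zero fun i hi => ?_
    have : k + 1 ≤ i := (mem_Ico.mp hi).1
    rw [hf, if_neg (by omega), if_neg (by omega)]; ring
  rw [h1, h2, h3]; ring

/-- **Mean zero:** `Σ_i N_iρ_if_k(i) = 0`. [ours] -/
theorem hubClass_eigen_mean_zero (hN : ∀ i, 0 < N i) (hR : ∀ k, R k = ∑ i ∈ range k, N i * ρ i)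
    (hf : ∀ k i, f k i = if i < k then ρ k else if i = k then -(R k / N k) else 0) {k : ℕ} (hk : k < m) :
    ∑ i ∈ range m, N i * ρ i * f k i = 0 := by
  have h := hubClass_eigen_sum hN hf hk (fun _ => 1)
  simp only [mul_one] at h
  rw [h, ← hR k]; ring

/-- **The norm:** `Σ_i N_iρ_if_k(i)² = ρ_kR_kR_{k+1}/N_k` (`R_{k+1} = R_k + N_kρ_k`). [ours] -/
theorem hubClass_eigen_normSq (hN : ∀ i, 0 < N i) (hR : ∀ k, R k = ∑ i ∈ range k, N i * ρ i)
    (hf : ∀ k i, f k i = if i < k then ρ k else if i = k then -(R k / N k) else 0) {k : ℕ} (hk : k < m) :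
    ∑ i ∈ range m, N i * ρ i * f k i ^ 2 = ρ k * R k * R (k + 1) / N k := by
  have h := hubClass_eigen_sum hN hf hk (f k)
  have e : ∑ i ∈ range m, N i * ρ i * f k i ^ 2 = ∑ i ∈ range m, N i * ρ i * f k i * f k i := sum_congr rfl fun i _ => by ring
  rw [e, h]
  have h1 : ∑ i ∈ range k, N i * ρ i * f k i = ρ k * R k := by
    rw [hR k, mul_sum]; exact sum_congr rfl fun i hi => by rw [hf, if_pos (mem_range.mp hi)]; ring
  rw [h1, hf k k, if_neg (lt_irrefl k), if_pos rfl, hR (k + 1), sum_range_succ, ← hR k]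
  have := (hN k).ne'
  field_simp
  ring

/-- **Orthogonality:** `Σ_i N_iρ_if_k(i)f_l(i) = 0` for `k ≠ l`. [ours] -/
theorem hubClass_eigen_orth (hN : ∀ i, 0 < N i) (hR : ∀ k, R k = ∑ i ∈ range k, N i * ρ i)
    (hf : ∀ k i, f k i = if i < k then ρ k else if i = k then -(R k / N k) else 0)
    {k l : ℕ} (hk : k < m) (hl : l < m) (hkl : k ≠ l) : ∑ i ∈ range m, N i * ρ i * f k i * f l i = 0 := by
  wlog hlt : k < l generalizing k l
  · have h := this hl hk (Ne.symm hkl) (by omega)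
    rw [← h]; exact sum_congr rfl fun i _ => by ring
  rw [hubClass_eigen_sum hN hf hk]
  have h1 : ∑ i ∈ range k, N i * ρ i * f l i = ρ l * R k := by
    rw [hR k, mul_sum]; exact sum_congr rfl fun i hi => by rw [hf l i, if_pos (by have := mem_range.mp hi; omega)]; ring
  rw [h1, hf l k, if_pos hlt]; ring

/-! ### §4 Completeness -/

/-- The deeper-than-`j` part of the completeness sum: `Σ_{j<k<m} f_k(i)f_k(j)N_k/(ρ_kR_kR_{k+1}) = 1/R_{j+1} − 1/R_m` for `i ≤ j`. [ours] -/
theorem hubClass_complete_tail (hρ : ∀ i, 0 < ρ i) (hN : ∀ i, 0 < N i) (hR : ∀ k, R k = ∑ i ∈ range k, N i * ρ i)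
    (hf : ∀ k i, f k i = if i < k then ρ k else if i = k then -(R k / N k) else 0) {i j : ℕ} (hij : i ≤ j) (hj : j < m) :
    ∑ k ∈ Ico (j + 1) m, f k i * f k j * N k / (ρ k * R k * R (k + 1)) = 1 / R (j + 1) - 1 / R m := by
  rw [← hubChain_telescope hj]
  refine sum_congr rfl fun k hk => ?_
  have hk1 : j + 1 ≤ k := (mem_Ico.mp hk).1
  have hRk : 0 < R k := by
    rw [hR k]; exact sum_pos (fun i _ => mul_pos (hN i) (hρ i)) ⟨0, mem_range.mpr (by omega)⟩
  have hRk1 : R (k + 1) = R k + N k * ρ k := by rw [hR (k + 1), sum_range_succ, ← hR k]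
  rw [hf k i, if_pos (by omega), hf k j, if_pos (by omega), hRk1]
  have hρk := hρ k; have hNk := hN k
  field_simp
  ring

/-- **COMPLETENESS (class weights).**  For `i, j < m`: `N_jρ_j·(1/R_m + Σ_{k<m} f_k(i)f_k(j)N_k/(ρ_kR_kR_{k+1})) = δ_{ij}`. [ours] -/
theorem hubClass_complete (hρ : ∀ i, 0 < ρ i) (hN : ∀ i, 0 < N i) (hR : ∀ k, R k = ∑ i ∈ range k, N i * ρ i)
    (hf : ∀ k i, f k i = if i < k then ρ k else if i = k then -(R k / N k) else 0) {i j : ℕ} (hi : i < m) (hj : j < m) :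
    N j * ρ j * (1 / R m + ∑ k ∈ range m, f k i * f k j * N k / (ρ k * R k * R (k + 1))) = if i = j then 1 else 0 := by
  wlog hij : i ≤ j generalizing i j
  · have hji : j ≤ i := by omega
    have h := this hj hi hji
    rw [if_neg (by omega)] at h
    rw [if_neg (by omega)]
    have hb : 1 / R m + ∑ k ∈ range m, f k j * f k i * N k / (ρ k * R k * R (k + 1)) = 0 := by
      rcases mul_eq_zero.mp h with h0 | h0
      · exact absurd h0 (mul_pos (hN i) (hρ i)).ne'
      · exact h0
    rw [show (∑ k ∈ range m, f k i * f k j * N k / (ρ k * R k * R (k + 1))) = ∑ k ∈ range m, f k j * f k i * N k / (ρ k * R k * R (k + 1)) from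
      sum_congr rfl fun k _ => by rw [mul_comm (f k i)], hb, mul_zero]
  rw [hubChain_split3 hj, hubClass_complete_tail hρ hN hR hf hij hj]
  have h0 : ∑ k ∈ range j, f k i * f k j * N k / (ρ k * R k * R (k + 1)) = 0 := by
    refine sum_eq_zero fun k hk => ?_
    have : k < j := mem_range.mp hk
    rw [hf k j, if_neg (by omega), if_neg (by omega)]; simp
  rw [h0, zero_add]
  have hRj1 : R (j + 1) = R j + N j * ρ j := by rw [hR (j + 1), sum_range_succ, ← hR j]
  have hρj := hρ j; have hNj := hN j
  have hR0 : 0 ≤ R j := by rw [hR j]; exact sum_nonneg fun i _ => mul_nonneg (hN i).le (hρ i).le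
  have hRj1pos : 0 < R (j + 1) := by rw [hRj1]; nlinarith
  by_cases hlt : i < j
  · rw [if_neg (by omega), hf j i, if_pos hlt, hf j j, if_neg (lt_irrefl j), if_pos rfl]
    have hRj : 0 < R j := by rw [hR j]; exact sum_pos (fun i _ => mul_pos (hN i) (hρ i)) ⟨i, mem_range.mpr hlt⟩
    rw [hRj1]
    field_simp
    ring
  · have hieq : i = j := by omega
    subst hieq
    rw [if_pos rfl, hf i i, if_neg (lt_irrefl i), if_pos rfl, hRj1]
    by_cases hRj : R i = 0
    · rw [hRj]; simp; field_simp
    · field_simp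
      ring

end HubClassEigen

end Summit.Ventures.LatticeQCDFlow.Scaling
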